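import Summits.BirchSwinnertonDyer.BirchSwinnertonDyer.Theorems.SignedLowerHalvesSmallImageLowerHalfBothSignsLambdaLowerThreeNsAFE
import Summits.BirchSwinnertonDyer.BirchSwinnertonDyer.Theorems.SignedLowerHalvesSmallImageMuZeroOneSignMuControl
import Summits.BirchSwinnertonDyer.BirchSwinnertonDyer.Theorems.SignedLowerHalvesKobayashiMainConjectureSmallImageKatoIntegralOfMu
import Summits.BirchSwinnertonDyer.BirchSwinnertonDyer.Theorems.SignedLowerHalvesKobayashiLowerHalfLargeImageLambdaTwoStratumMainConjecture
import HarnessLib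

/-!
# Route `SignedLowerHalves` (K3), child crux L `SmallImageLowerHalfBothSigns` (item stmt-BirchSwinnertonDyer-23599),
# line `birth_acns`, stub `stub_lambdaLowerThree_ns`: the `λ = 2` CLOSER AT SMALL IMAGE — Kobayashi's main conjecture
# for `(E, p, ε)` at a NON-SURJECTIVE pair from the certificate `(μ, λ)(L_p^ε) = (0, 2)`, `Sel_{p^∞}(E/ℚ)` finite,
# `p ∣ Tam(E)·#Sel`, and the algebraic functional equation at the pair (cell `bsd-ssimc`, width seat `bsd-line-slh-p3-w3`
# gen 4; ROUTE-INDEPENDENT helper `--supports 23599`; no `Theses` import)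

HONEST FRAMING: CALIBRATION / SUPPORT ONLY — PER PAIR. Crux L, the stub and BSD are NOT proved; the class is infinite
and nothing class-wide is claimed. Every theorem is CONDITIONAL on DISPLAYED binders: the published named facts
Kobayashi 2003 Thm. 1.2 (`h12`), Thm. 4.1 rational display (`h41`), Thm. 6.2/6.3/7.3 Coleman–Kato `ζ`-package (`hCK`),
B. D. Kim 2013 Cor. 3.15 (`hK13`), the period units (`h5`, `h3`) — and the per-pair algebraic functional equation
`hAFE` (B. D. Kim 2008 Thm. 3.12 at the pair: a named fact for `p > 3`, the tree's TYPING REQUEST at `p = 3`) and the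
per-pair certificate / finiteness / divisibility inputs. THEOREMS ONLY; no definition, no named fact, no `sorry`.

## What is proved (odd good `p`, `a_p = 0`, `ρ̄_{E,p}` NOT onto — crux L's domain; per pair and sign)

* §1 `mu_charGen_eq_zero_of_mu_kobayashiL_eq_zero` — the analytic certificate `μ(L_p^ε) = 0` at sign `ε` gives the
  ALGEBRAIC `μ(ξ^ε) = 0` for every dual datum of that sign (crux M's brick
  `SmallImageMuControl.mu_eq_zero_of_isSignedPAdicLFunction_of_hasUnitContent`, LEAD 23600 g0, in `mu`-currency;
  `hCK h12 h5 h3`). So on the shadow stratum the `μ`-input of `…LambdaLowerThreeNsAFE` §2 is the certificate itself.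
* §2 **`kobayashiMainConjecture_of_cert_of_finite_of_dvd_of_afe_of_not_surj`** — the SMALL-IMAGE twin of slh-p1-w6's
  `LargeImageLambdaTwoStratum.kobayashiMainConjecture_of_lam_eq_two_of_finite_of_dvd_of_afe`: certificate `(0, 2)` for
  every signed `p`-adic `L`-function of the newform at sign `ε`, `Sel_{p^∞}(E/ℚ)` finite, `p ∣ ∏ c_ℓ · #Sel_{p^∞}(E/ℚ)`,
  `hAFE` ⟹ `KobayashiMainConjecture W p ε`. Proof: §1 gives `μ(ξ) = 0`; Kato made integral by `μ`
  (`SmallImageKatoIntegralOfMu.dvd_of_charIdeal_eq_span_of_mu_eq_zero`, p667339): `ξ ∣ L_p^ε`; the `T = 0` shadow of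
  `…LambdaLowerThreeNsAFE` (`two_le_lam_charGen_of_afe_of_dvd_of_mu_eq_zero`): `λ(ξ) ≥ 2 = λ(L_p^ε)`; squeeze
  `(ξ) = (L_p^ε)`. Corollaries: the Eisenstein half `KobayashiLowerDivisibility W p ε` (crux L's body AT THE PAIR and
  sign) and, with certificates at BOTH signs, `∀ ε, KobayashiLowerDivisibility W p ε`.
* §3 `lam_kobayashiL_le_lam_charGen_of_cert_of_not_surj` — the λ-stub's content at a datum from the Pollack pair's
  certificate `μ(L_p^ε) = 0 ∧ λ(L_p^ε) ≤ 2` (what the by-name reading of `stub_lambdaLowerThree_ns` consumes).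

READING (numbers, not adjectives): at a rank-`0` small-image pair with certificate `(μ, λ)(L_3^±) = (0, 2)` the ENTIRE
per-pair content of crux L (both halves: the main conjecture) is «`3 ∣ Tam(E)·#Sel_{3^∞}(E/ℚ)`» + AFE(3) + print — the
census of `(μ, λ)(L_3^±)` over the 96 rank-`0` window pairs (one kit pass, w3 g0 (e)) now prices the whole window.

References: [Kobayashi2003] Thm. 1.2, Thm. 4.1 (p. 8), Thm. 6.2–6.3 (p. 11), Thm. 7.3 (7.21) (p. 13), Conjecture (p. 2);
[Kato2004Asterisque] Thm. 12.5, Thm. 12.6, §13.8, §17.13; [KimBD2008MRL] Thm. 3.12 (p. 93); [BDKim2013] Cor. 3.15 (p. 199);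
[GreenbergVatsal2000] p. 2 (1)–(2), p. 4, §3 Rem. 3.4; [Mazur1978] Cor. 4.1; [Washington1997] §7.1, §13.1–13.2.
-/

set_option autoImplicit false
-- D-0017: single-problem summit, the namespace repeats the problem name by design.
set_option linter.dupNamespace false

noncomputable section

open scoped Classical MatrixGroups ModularForm

open CongruenceSubgroup PowerSeries WeierstrassCurve Field Literature.NumberTheory.EllipticCurves
  Literature.NumberTheory.EllipticCurves.ModularForms
  Literature.NumberTheory.EllipticCurves.Rank1Residual
  Literature.NumberTheory.EllipticCurves.Kobayashi2003 ZpExtension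
  Literature.NumberTheory.EllipticCurves.GreenbergVatsal2000
  Literature.NumberTheory.EllipticCurves.Rank1Residual.Typed
  Summit.BirchSwinnertonDyer.Rank1Residual
  Summit.BirchSwinnertonDyer.Rank1Residual.X1.MuLambda
  Summit.BirchSwinnertonDyer.Rank1Residual.Supersingular

namespace Summit.BirchSwinnertonDyer.BirchSwinnertonDyer.Theorems.SmallImageLambdaLowerThreeNsAFEClosure

open SmallImageLambdaLowerThreeNsDoor SmallImageLambdaLowerThreeNsAFE LargeImageLambdaTwoStratum

/-! ## §1. The analytic certificate `μ(L_p^ε) = 0` gives the algebraic `μ(ξ^ε) = 0` at non-surjective image -/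

section Mu

variable (W : WeierstrassCurve ℚ) [W.IsElliptic] [W.IsGloballyMinimal] (p : ℕ) [Fact p.Prime]

/-- **`μ(L_p^ε) = 0` ⟹ `μ(ξ^ε) = 0` at a NON-SURJECTIVE pair** (crux M's brick in `mu`-currency). Odd good `p`, `a_p = 0`,
`ρ̄_{E,p}` not onto, the newform `f` of level `N_E`, a Pollack pair whose `L_p^ε = kobayashiL ε L⁺ L⁻` has `μ = 0`
(`mu`, so `L_p^ε` has a unit coefficient), a cyclotomic frame at the pinned variable, a dual datum `D` of `Sel^ε(E/ℚ_∞)`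
with generator `ξ`: `μ(ξ) = 0`. GRANTED BY NAME `hCK` (Kobayashi Thm. 6.2/6.3/7.3), `h12`, `h5`/`h3`; the work is LEAD
23600 g0's `SmallImageMuControl.mu_eq_zero_of_isSignedPAdicLFunction_of_hasUnitContent`.
[cite: Kobayashi2003, Thm. 1.2 (p. 2), Thm. 6.2–6.3 (p. 11), Thm. 7.3 (7.21) (p. 13)] [cite: Kato2004Asterisque, Thm. 12.6, §13.8]
[cite: GreenbergVatsal2000, p. 2, (1)–(2)] -/
theorem mu_charGen_eq_zero_of_mu_kobayashiL_eq_zero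
    (hCK : thm62_63_73_signedColemanKato_zeta) (h12 : thm12_signedSelmerDual_finite_torsion)
    (h5 : realPeriodRat_eq_unit_mul_plusPeriod) (h3 : realPeriodRat_eq_unit_mul_plusPeriod_three)
    (hp : p ≠ 2) (hgood : W.HasGoodReductionAtPrime p) (hap : W.frobeniusTrace p = 0) (hs : ¬ Surj W p)
    [NeZero (W.conductorNorm ℤ)] {f : CuspForm (Gamma0 (W.conductorNorm ℤ)) 2} (hf : IsNewformOf W f)
    {ε : ℤˣ} {Lplus Lminus : IwasawaAlgebra p} (hPP : IsPollackPair f p Lplus Lminus)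
    (hμL : mu (kobayashiL ε Lplus Lminus) = 0)
    {κ : ZpExtension ℚ p} {γ : absoluteGaloisGroup ℚ} (hκ : κ.IsCyclotomic) (hγ : κ.IsTopGenerator γ)
    (hγ' : IsCyclotomicVariable p γ) (D : SignedSelmerDualData W κ γ ε)
    {ξ : IwasawaAlgebra p} (hξ : D.charIdeal = Ideal.span {ξ}) : mu ξ = 0 := by
  have hL0 : kobayashiL ε Lplus Lminus ≠ 0 := IsPollackPair.kobayashiL_ne_zero p hPP ε
  -- `μ = 0` ⟹ the `λ`-th coefficient is a unit (`p ∤ coeff λ`)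
  have hu : HasUnitContent (kobayashiL ε Lplus Lminus) := by
    refine ⟨lam (kobayashiL ε Lplus Lminus), ?_⟩
    by_contra hnu
    exact not_dvd_coeff_lam hL0 hμL
      ((PadicInt.norm_lt_one_iff_dvd _).mp (PadicInt.mem_nonunits.mp (mem_nonunits_iff.mpr hnu)))
  exact SmallImageMuControl.mu_eq_zero_of_isSignedPAdicLFunction_of_hasUnitContent W p hCK h12 h5 h3 hp hgood hap hs
    f hf (hPP.isSignedPAdicLFunction_kobayashiL ε) hu κ γ hκ hγ hγ' D hξ

end Mu

/-! ## §2. The `λ = 2` closer at small image: Kobayashi's main conjecture at the pair and sign -/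

section Closer

variable (W : WeierstrassCurve ℚ) [W.IsElliptic] [W.IsGloballyMinimal] (p : ℕ) [Fact p.Prime]

/-- **Kobayashi's main conjecture for `(E, p, ε)` at a NON-SURJECTIVE pair with certificate `(μ, λ)(L_p^ε) = (0, 2)`,
`Sel_{p^∞}(E/ℚ)` FINITE, `p ∣ ∏_ℓ c_ℓ · #Sel_{p^∞}(E/ℚ)`, GRANTED the algebraic functional equation AT THE PAIR** (`hAFE`:
for every cyclotomic `κ`, topological generator `γ` and dual datum `D` of `Sel^ε(E/ℚ_∞)`, `ι(Char X^ε) = Char X^ε` —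
Kim 2008 Thm. 3.12 at `(W, p, ε)`, a named fact for `p > 3`, a HYPOTHESIS at `p = 3`) and BY NAME `h12`, `h41`
(rational display only), `hCK`, `hK13`, `h5`, `h3`. Odd good `p`, `a_p = 0`. Proof: `μ(ξ) = 0` (§1, from `μ(L_p^ε) = 0`);
`ξ ∣ L_p^ε` (Kato made integral by `μ`, p667339); `p ∣ ξ(0) ≠ 0` (Kim 2013), so `λ(ξ) ≥ 1`, and `λ(ξ)` is even by the
functional equation at a rank-`0` pair (`…LambdaLowerThreeNsAFE` §1–§2), so `λ(ξ) = 2 = λ(L_p^ε)` and `(ξ) = (L_p^ε)`.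
The small-image twin of slh-p1-w6's `kobayashiMainConjecture_of_lam_eq_two_of_finite_of_dvd_of_afe` (there `ρ̄` onto
makes Kato integral; here the analytic `μ = 0` does, through crux M's brick). PER PAIR; CONDITIONAL on the displayed
binders. [cite: Kobayashi2003, Thm. 1.2, Thm. 4.1 (p. 8), Thm. 6.2–6.3, Thm. 7.3 (7.21) and Conjecture (p. 2)]
[cite: KimBD2008MRL, Thm. 3.12 (p. 93) and §1 p. 83] [cite: BDKim2013, Cor. 3.15 (p. 199)] [cite: Kato2004Asterisque, Thm. 12.5–12.6, §13.8]
[cite: GreenbergVatsal2000, p. 4 and §3 Remark 3.4] -/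
theorem kobayashiMainConjecture_of_cert_of_finite_of_dvd_of_afe_of_not_surj
    (h12 : thm12_signedSelmerDual_finite_torsion) (h41 : thm41_signedCharIdeal_divisibility)
    (hCK : thm62_63_73_signedColemanKato_zeta) (hK13 : BDKim2013.cor315_signedCharValue_rankZero)
    (h5 : realPeriodRat_eq_unit_mul_plusPeriod) (h3 : realPeriodRat_eq_unit_mul_plusPeriod_three)
    (hp : p ≠ 2) (hgood : W.HasGoodReductionAtPrime p) (hap : W.frobeniusTrace p = 0) (hs : ¬ Surj W p) (ε : ℤˣ)
    (hAFE : ∀ (κ : ZpExtension ℚ p) (γ : absoluteGaloisGroup ℚ), κ.IsCyclotomic → κ.IsTopGenerator γ →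
      ∀ D : SignedSelmerDualData W κ γ ε, Ideal.map (IwasawaAlgebra.invol p) D.charIdeal = D.charIdeal)
    [NeZero (W.conductorNorm ℤ)] {f₀ : CuspForm (Gamma0 (W.conductorNorm ℤ)) 2} (hf₀ : IsNewformOf W f₀)
    (hcert₀ : ∀ L : IwasawaAlgebra p, IsSignedPAdicLFunction f₀ p ε L → mu L = 0 ∧ lam L = 2)
    (hfin : Finite (W.selmerGroupPInfty p)) (hdvd : p ∣ W.tamagawaProduct * Nat.card (W.selmerGroupPInfty p)) :
    KobayashiMainConjecture W p ε := by
  intro κ γ hκ hγ hγ' _ f hf ϖ hϖ Lplus Lminus hPP D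
  have hff : f = f₀ := hf.unique hf₀
  subst hff
  haveI : Module.Finite (IwasawaAlgebra p) D.X := h12.moduleFinite hp hgood hap hκ hγ D
  have hX : Module.IsTorsion (IwasawaAlgebra p) D.X := h12.isTorsion hp hgood hap hκ hγ D
  refine ⟨hX, ?_⟩
  obtain ⟨ξ, hξ⟩ := (charIdeal_isPrincipal_holds p D.X).principal
  have hξ' : D.charIdeal = Ideal.span {ξ} := hξ
  set L := kobayashiL ε Lplus Lminus with hL_def
  have hL : IsSignedPAdicLFunction f p ε L := hPP.isSignedPAdicLFunction_kobayashiL ε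
  have hL0 : L ≠ 0 := IsPollackPair.kobayashiL_ne_zero p hPP ε
  obtain ⟨hμ, hlam⟩ := hcert₀ L hL
  -- `μ(ξ) = 0` at this sign (crux M's brick, analytic `μ = 0`, non-surjective image)
  have hμξ : mu ξ = 0 :=
    mu_charGen_eq_zero_of_mu_kobayashiL_eq_zero W p hCK h12 h5 h3 hp hgood hap hs hf hPP hμ hκ hγ hγ' D hξ'
  -- Kato made integral by `μ`: `ξ ∣ L`
  have hU : ξ ∣ L :=
    SmallImageKatoIntegralOfMu.dvd_of_charIdeal_eq_span_of_mu_eq_zero h41 hp hgood hap hf hκ hγ hγ' hL hL0 D hX hξ' hμξ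
  -- the `T = 0` shadow + functional equation: `λ(ξ) ≥ 2`
  have hlamξ : 2 ≤ lam ξ :=
    two_le_lam_charGen_of_afe_of_dvd_of_mu_eq_zero h12 hK13 hp hgood hap hκ hγ D hξ' (hAFE κ γ hκ hγ D) hfin hdvd hμξ
  have hspan : Ideal.span ({ξ} : Set (IwasawaAlgebra p)) = Ideal.span {L} :=
    span_eq_span_of_dvd_of_lam_le hL0 hU hμ (by rw [hlam]; exact hlamξ)
  exact exists_generator_of_span_eq W p h5 h3 hp hgood hap hf hϖ hξ' hspan

/-- **Corollary — the Eisenstein half at the pair and sign** (`KobayashiLowerDivisibility W p ε`, crux L's body at ONE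
pair and sign) under the hypotheses of `kobayashiMainConjecture_of_cert_of_finite_of_dvd_of_afe_of_not_surj`.
[cite: Kobayashi2003, Conjecture (p. 2)] [cite: KimBD2008MRL, Thm. 3.12 (p. 93)] [cite: BDKim2013, Cor. 3.15 (p. 199)] -/
theorem kobayashiLowerDivisibility_of_cert_of_finite_of_dvd_of_afe_of_not_surj
    (h12 : thm12_signedSelmerDual_finite_torsion) (h41 : thm41_signedCharIdeal_divisibility)
    (hCK : thm62_63_73_signedColemanKato_zeta) (hK13 : BDKim2013.cor315_signedCharValue_rankZero)
    (h5 : realPeriodRat_eq_unit_mul_plusPeriod) (h3 : realPeriodRat_eq_unit_mul_plusPeriod_three)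
    (hp : p ≠ 2) (hgood : W.HasGoodReductionAtPrime p) (hap : W.frobeniusTrace p = 0) (hs : ¬ Surj W p) (ε : ℤˣ)
    (hAFE : ∀ (κ : ZpExtension ℚ p) (γ : absoluteGaloisGroup ℚ), κ.IsCyclotomic → κ.IsTopGenerator γ →
      ∀ D : SignedSelmerDualData W κ γ ε, Ideal.map (IwasawaAlgebra.invol p) D.charIdeal = D.charIdeal)
    [NeZero (W.conductorNorm ℤ)] {f₀ : CuspForm (Gamma0 (W.conductorNorm ℤ)) 2} (hf₀ : IsNewformOf W f₀)
    (hcert₀ : ∀ L : IwasawaAlgebra p, IsSignedPAdicLFunction f₀ p ε L → mu L = 0 ∧ lam L = 2)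
    (hfin : Finite (W.selmerGroupPInfty p)) (hdvd : p ∣ W.tamagawaProduct * Nat.card (W.selmerGroupPInfty p)) :
    KobayashiLowerDivisibility W p ε :=
  kobayashiLowerDivisibility_of_mainConjecture
    (kobayashiMainConjecture_of_cert_of_finite_of_dvd_of_afe_of_not_surj W p h12 h41 hCK hK13 h5 h3 hp hgood hap hs ε
      hAFE hf₀ hcert₀ hfin hdvd)

/-- **Corollary — crux L's body `∀ ε, KobayashiLowerDivisibility W p ε` AT ONE PAIR from the certificate `(0, 2)` at BOTH
signs** (every other hypothesis as in §2, the functional equation at the pair for both signs). PER PAIR; the crux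
(ALL small-image X7 pairs) is NOT proved. [cite: Kobayashi2003, Conjecture (p. 2)] [cite: KimBD2008MRL, Thm. 3.12 (p. 93)]
[cite: BDKim2013, Cor. 3.15 (p. 199)] -/
theorem forall_kobayashiLowerDivisibility_of_certs_of_finite_of_dvd_of_afe_of_not_surj
    (h12 : thm12_signedSelmerDual_finite_torsion) (h41 : thm41_signedCharIdeal_divisibility)
    (hCK : thm62_63_73_signedColemanKato_zeta) (hK13 : BDKim2013.cor315_signedCharValue_rankZero)
    (h5 : realPeriodRat_eq_unit_mul_plusPeriod) (h3 : realPeriodRat_eq_unit_mul_plusPeriod_three)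
    (hp : p ≠ 2) (hgood : W.HasGoodReductionAtPrime p) (hap : W.frobeniusTrace p = 0) (hs : ¬ Surj W p)
    (hAFE : ∀ (ε : ℤˣ) (κ : ZpExtension ℚ p) (γ : absoluteGaloisGroup ℚ), κ.IsCyclotomic → κ.IsTopGenerator γ →
      ∀ D : SignedSelmerDualData W κ γ ε, Ideal.map (IwasawaAlgebra.invol p) D.charIdeal = D.charIdeal)
    [NeZero (W.conductorNorm ℤ)] {f₀ : CuspForm (Gamma0 (W.conductorNorm ℤ)) 2} (hf₀ : IsNewformOf W f₀)
    (hcert : ∀ (ε : ℤˣ) (L : IwasawaAlgebra p), IsSignedPAdicLFunction f₀ p ε L → mu L = 0 ∧ lam L = 2)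
    (hfin : Finite (W.selmerGroupPInfty p)) (hdvd : p ∣ W.tamagawaProduct * Nat.card (W.selmerGroupPInfty p)) :
    ∀ ε : ℤˣ, KobayashiLowerDivisibility W p ε :=
  fun ε ↦ kobayashiLowerDivisibility_of_cert_of_finite_of_dvd_of_afe_of_not_surj W p h12 h41 hCK hK13 h5 h3 hp hgood
    hap hs ε (hAFE ε) hf₀ (hcert ε) hfin hdvd

end Closer

/-! ## §3. The λ-stub's content at a datum from the Pollack pair's certificate -/

section Stub

variable {p : ℕ} [Fact p.Prime] {W : WeierstrassCurve ℚ} [W.IsElliptic] [W.IsGloballyMinimal]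
  {κ : ZpExtension ℚ p} {γ : absoluteGaloisGroup ℚ} {ε : ℤˣ}

/-- **The Eisenstein λ-inequality at a datum from the certificate `μ(L_p^ε) = 0 ∧ λ(L_p^ε) ≤ 2`, at a NON-SURJECTIVE
pair** — the shape w3 g0's by-name reading `smallImageLambdaLowerAtThree_iff_lamLe` consumes: odd good `p`, `a_p = 0`,
`ρ̄` not onto, cyclotomic frame, newform `f`, Pollack pair with `μ(L_p^ε) = 0`, `λ(L_p^ε) ≤ 2`, datum `D` with
generator `ξ` and the functional equation at `D`, `Sel_{p^∞}(E/ℚ)` finite, `p ∣ ∏ c_ℓ · #Sel`; granted `h12 hCK hK13 h5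
h3`: `λ(L_p^ε) ≤ λ(ξ^ε)` (§1 + `…LambdaLowerThreeNsAFE.lam_le_lam_charGen_of_afe_of_lam_le_two`; NO `h41`).
[cite: Kobayashi2003, Thm. 1.2, Thm. 6.2–6.3, Thm. 7.3 (7.21) and Conjecture (p. 2)] [cite: KimBD2008MRL, Thm. 3.12 (p. 93)]
[cite: BDKim2013, Cor. 3.15 (p. 199)] -/
theorem lam_kobayashiL_le_lam_charGen_of_cert_of_not_surj
    (h12 : thm12_signedSelmerDual_finite_torsion) (hCK : thm62_63_73_signedColemanKato_zeta)
    (hK13 : BDKim2013.cor315_signedCharValue_rankZero)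
    (h5 : realPeriodRat_eq_unit_mul_plusPeriod) (h3 : realPeriodRat_eq_unit_mul_plusPeriod_three)
    (hp : p ≠ 2) (hgood : W.HasGoodReductionAtPrime p) (hap : W.frobeniusTrace p = 0) (hs : ¬ Surj W p)
    [NeZero (W.conductorNorm ℤ)] {f : CuspForm (Gamma0 (W.conductorNorm ℤ)) 2} (hf : IsNewformOf W f)
    (hκ : κ.IsCyclotomic) (hγ : κ.IsTopGenerator γ) (hγ' : IsCyclotomicVariable p γ)
    {Lplus Lminus : IwasawaAlgebra p} (hPP : IsPollackPair f p Lplus Lminus)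
    (hμL : mu (kobayashiL ε Lplus Lminus) = 0) (hL2 : lam (kobayashiL ε Lplus Lminus) ≤ 2)
    (D : SignedSelmerDualData W κ γ ε) {ξ : IwasawaAlgebra p} (hξ : D.charIdeal = Ideal.span {ξ})
    (hAFE : Ideal.map (IwasawaAlgebra.invol p) D.charIdeal = D.charIdeal)
    (hfin : Finite (W.selmerGroupPInfty p)) (hdvd : p ∣ W.tamagawaProduct * Nat.card (W.selmerGroupPInfty p)) :
    lam (kobayashiL ε Lplus Lminus) ≤ lam ξ :=
  lam_le_lam_charGen_of_afe_of_lam_le_two h12 hK13 hp hgood hap hκ hγ D hξ hAFE hfin hdvd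
    (mu_charGen_eq_zero_of_mu_kobayashiL_eq_zero W p hCK h12 h5 h3 hp hgood hap hs hf hPP hμL hκ hγ hγ' D hξ) hL2

end Stub

end Summit.BirchSwinnertonDyer.BirchSwinnertonDyer.Theorems.SmallImageLambdaLowerThreeNsAFEClosure

end
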